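import Summits.CriticalPhenomena.PercolationContinuityZ3.Theorems.TransplantMonotonicTreeHarris
import Literature.Probability.Percolation.DecisionTreeBK
import HarnessLib

/-!
# FK sub-lane: Gladkov decision trees as `MonotonicTree.DTr` trees (definition)

Definitions file (`--supports stmt-CriticalPhenomena-4575`), FK sub-lane `prim-bschramm-fk-2` (gen 3); builds on p205010 (kernel
theorem, internal audit signed; external expert review pending).  No theorems, no named facts, no sorries.

The tree's two decision-tree types: `Literature.Probability.Percolation.DTree ι` (Gladkov 2024 formalisation:
`node e yes no`, used by `SetClusterExploration.ttree`, the full exploration of the open cluster of a vertex set) and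
`Summit.….MonotonicTree.DTr ι` (p207809: `node e t0 t1`, closed child first, used by `FK.treeHarris_rc`, the decision-tree
Harris inequality for `φ_{𝐩,q}`).  `FK.dtrOfDTree` converts the former into the latter (swapping the children), so that the
cluster exploration tree can be fed to `FK.treeHarris_rc` (bschramm/FK-Q2.md §12.3: Lemma `P_v` for `φ_{𝐩,q}`).
[cite: Gladkov2024, Def. 2.4, Example 2.5 (p. 3)]
-/

namespace Summit.CriticalPhenomena.PercolationContinuityZ3.Theorems.FK

open Literature.Probability.Percolation (DTree)
open Summit.CriticalPhenomena.PercolationContinuityZ3.Theorems.MonotonicTree (DTr)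

/-- A Gladkov decision tree (`node e yes no`) as a `MonotonicTree.DTr` (`node e t0 t1`: closed child first).
[cite: Gladkov2024, Def. 2.4 (p. 3)] -/
def dtrOfDTree {ι : Type*} : DTree ι → DTr ι
  | .leaf => .leaf
  | .node e yes no => .node e (dtrOfDTree no) (dtrOfDTree yes)

end Summit.CriticalPhenomena.PercolationContinuityZ3.Theorems.FK
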